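import Summits.BirchSwinnertonDyer.BirchSwinnertonDyer.Theses.ShaPrimaryTransfer
import Summits.BirchSwinnertonDyer.BirchSwinnertonDyer.Theses.KatoTransfer
import Literature.NumberTheory.EllipticCurves.IwasawaLeadingTermProofs
import Literature.NumberTheory.EllipticCurves.Zywina2025Torsion
import Literature.NumberTheory.EllipticCurves.SupersingularDensityProofs
import Mathlib.Tactic.NormNum.Prime

/-!
# BirchSwinnertonDyer / ShaPrimaryTransfer — crux `FiniteShaComponentTransfer` (stmt-BirchSwinnertonDyer-22356):
# the door at 2 IS OPEN AT RANK 2 in the kernel (Zywina's family), and what T then predicts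

Route `ShaPrimaryTransfer` (D-0145 LINE 2) splits KatoTransfer's X1 into the DOOR O =
`OneFiniteShaComponent` («every `E/ℚ` has some prime `p₀` with `t_{p₀}(E) = corank_{ℤ_{p₀}} Ш(E)[p₀^∞] = 0`,
to be decided curve by curve by complete 2-descent») and the TRANSFER T = `FiniteShaComponentTransfer`
(«`t_p(E) = 0 ⟹ t_q(E) = 0`»). The companion files (`…Slices`, `…Sectors`, `…DoorAtTwo`) show that both
are settled below analytic / algebraic rank 2 by Gross–Zagier–Kolyvagin and the printed `p`-converses, and
are OPEN from rank 2 on. This file exhibits the FIRST CELL OF THAT OPEN SECTOR INSIDE THE KERNEL: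

* §0–§1 THE DOOR AT 2, RANK 2, UNCONDITIONALLY. For every admissible pair `(m, n)` of Zywina's family
  `E_{m,n} : y² = x³ − 5(m+16n²)x² + 4(m+16n²)(m+25n²)x` (`m`, `m+16n²`, `m+25n²` primes `≡ 11 (mod 24)`;
  D. Zywina, arXiv:2502.01957, Thm. 1.2) the tree PROVES `rank E_{m,n}(ℚ) = 2` (descent via 2-isogeny,
  `Zywina2025.mordellWeilRank_zywinaCurve`) and `Ш(E_{m,n}/ℚ)[2^∞] = 0` (`Zywina2025.shaCorank_two_zywinaCurve`),
  with no named fact. So O HOLDS on this rank-2 family (`oneFiniteShaComponent_zywinaCurve`), an explicit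
  member is `(m, n) = (659, 12)` (`zywinaAdmissible_659_12`: `659`, `2963`, `4259` are primes `≡ 11 (mod 24)`),
  and the open sector «rank `≥ 2`» of O and of T's hypothesis is INHABITED by a kernel-certified curve
  (`exists_rank_two_door_at_two`). Numbers: the door datum is `(E_{659,12}, p₀ = 2, rank 2, t_2 = 0)`.
* §2 T'S FIRST OPEN INSTANCES, EXPLICIT. Granting T, every `t_q(E_{m,n})` vanishes, i.e.
  `corank_{ℤ_q} Sel_{q^∞}(E_{m,n}/ℚ) = 2` and `Ш(E_{m,n})[q^∞]` is finite at EVERY prime `q`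
  (`shaCorank_zywinaCurve_eq_zero_of_transfer`, `selmerCorank_zywinaCurve_of_transfer`). These are
  statements about named curves and arbitrary primes that no theorem in print decides (rank 2): they are
  exactly what the route's «cross-prime table» instrument would have to certify, curve by curve.
* §3 WHAT AN INSTRUMENT MUST CERTIFY (unconditional). On the family `corank Sel_{q^∞} = 2 + t_q`
  (Greenberg's identity, tree theorem), so `t_q(E_{m,n}) = 0 ⟺ corank_{ℤ_q} Sel_{q^∞}(E_{m,n}/ℚ) ≤ 2`
  (`shaCorank_zywinaCurve_eq_zero_iff`): an upper bound `2` on the `q^∞`-Selmer corank (e.g. a `λ`-door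
  `μ_q = 0, λ_q = 2` through Kato's divisibility) is necessary and sufficient.
* §4 PARITY is consistent and idle: granting `p`-parity at `2`, `w(E_{m,n}) = +1`
  (`rootNumber_zywinaCurve_of_two_parity`); granting it at `2` and `q`, `t_q(E_{m,n})` is EVEN
  (`even_shaCorank_zywinaCurve_of_p_parity`); T asks for `0`.
* §5 RANK-BSD FOR THE FAMILY FROM THE ROUTE'S CRUXES. `ord_{s=1} L(E_{m,n}, s) = 2 = rank E_{m,n}(ℚ)`
  follows from T, KatoTransfer's X2 = `AnalyticRankLeSelmerCorank` (at a good ordinary prime `q ≥ 5` of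
  `E_{m,n}`, which EXISTS by the tree theorem `infinite_goodOrdinaryPrimes_holds`) and Gross–Zagier–Kolyvagin
  (`analyticRank_zywinaCurve_eq_two_of_transfer`); the upper bound `ord ≤ 2` needs only T ∧ X2
  (or X1 ∧ X2 of KatoTransfer, `analyticRank_zywinaCurve_le_two_of_X1_X2`), the lower bound `2 ≤ ord` only GZK.
* §6 T on the family's door data is exactly «`Ш(E_{m,n})[q^∞]` finite for all admissible `(m, n)`, all `q`»
  (`transfer_on_zywinaFamily_iff`): one admissible pair and one prime with an infinite component refute T.

Helper file of prover seat `bsd-line-spt-p1` (g2), `--supports stmt-22356 --as helper`. Nothing here proves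
T, O class-wide, X2 or BSD; T remains conjecture-grade at rank ≥ 2 — this file only pins its first open
instances to explicit, kernel-certified curves.

References: D. Zywina, *There are infinitely many elliptic curves over the rationals of rank 2*,
arXiv:2502.01957 (2025), Thm. 1.2, Lemmas 3.1–3.5; R. Greenberg, LNM 1716 (1999), §1 pp. 54–57;
T. and V. Dokchitser, Ann. of Math. 172 (2010), Thm. 1.4; V. Kolyvagin (1990), Thm. A; J.-P. Serre,
Publ. Math. IHÉS 54 (1981), §8 (ordinary primes).
-/

-- D-0017: single-problem summit, so `Summit.BirchSwinnertonDyer.BirchSwinnertonDyer.…` repeats a namespace BY DESIGN.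
set_option linter.dupNamespace false

noncomputable section

namespace Summit.BirchSwinnertonDyer.BirchSwinnertonDyer.Theorems.ShaPrimaryTransferRankTwoDoor

open scoped Classical
open Literature.NumberTheory.EllipticCurves Literature.NumberTheory.EllipticCurves.Zywina2025
open WeierstrassCurve
open Summit.BirchSwinnertonDyer.BirchSwinnertonDyer.Theses.ShaPrimaryTransfer
  (FiniteShaComponentTransfer OneFiniteShaComponent AnalyticRankLeSelmerCorank)
open Summit.BirchSwinnertonDyer.BirchSwinnertonDyer.Theses.KatoTransfer (ShaCorankZeroAtOnePrime)

/-! ## §0 An explicit admissible pair -/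

/-- `(m, n) = (659, 12)` is admissible for Zywina's Theorem 1.2: `m = 659`, `m + 16n² = 2963` and
`m + 25n² = 4259` are primes congruent to `11` modulo `24` (and `n > 0`). [cite: Zywina2025, Thm 1.2] -/
theorem zywinaAdmissible_659_12 : ZywinaAdmissible 659 12 := by
  refine ⟨by norm_num, by norm_num, by norm_num, by norm_num, by norm_num, by norm_num, by norm_num⟩

/-! ## §1 The door at 2 is open at rank 2 (unconditional) -/

variable {m n : ℕ}

/-- **The door datum of Zywina's family.** For admissible `(m, n)`: `rank E_{m,n}(ℚ) = 2` and
`t_2(E_{m,n}) = corank_{ℤ₂} Ш(E_{m,n}/ℚ)[2^∞] = 0` — both PROVED in the tree by the descent via 2-isogeny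
(`mordellWeilRank_zywinaCurve`, `shaCorank_two_zywinaCurve`). [cite: Zywina2025, Thm 1.2 and §1 (remark after Thm 1.2)] -/
theorem door_two_zywinaCurve (h : ZywinaAdmissible m n) :
    (zywinaCurve m n).mordellWeilRank = 2 ∧ (zywinaCurve m n).shaCorank 2 = 0 :=
  ⟨mordellWeilRank_zywinaCurve h, shaCorank_two_zywinaCurve h⟩

/-- **O holds on Zywina's rank-2 family, unconditionally**: `E_{m,n}` has a prime (`p₀ = 2`) with
`corank_{ℤ_{p₀}} Ш(E_{m,n})[p₀^∞] = 0`. This is the route's «door decided curve by curve by 2-descent» at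
RANK 2 — the first rank where O is open class-wide. [cite: Zywina2025, §1 (remark after Thm 1.2)] -/
theorem oneFiniteShaComponent_zywinaCurve (h : ZywinaAdmissible m n) :
    ∃ (p : ℕ) (_ : Fact p.Prime), (zywinaCurve m n).shaCorank p = 0 :=
  ⟨2, ⟨Nat.prime_two⟩, shaCorank_two_zywinaCurve h⟩

/-- `Ш(E_{m,n}/ℚ)[2^∞]` is finite (indeed trivial: `primaryComponent_sha_two_zywinaCurve`).
[cite: Zywina2025, §1 (remark after Thm 1.2)] -/
theorem finite_sha_primary_two_zywinaCurve (h : ZywinaAdmissible m n) :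
    Finite ↥(AddCommGroup.primaryComponent (zywinaCurve m n).sha 2) := by
  rw [primaryComponent_sha_two_zywinaCurve h]
  infer_instance

/-- **The open sector of O / of T's hypothesis is inhabited in the kernel**: there is an elliptic curve over
`ℚ` of Mordell–Weil rank `2` whose `2`-primary Tate–Shafarevich group has corank `0` (witness `E_{659,12}`).
No named fact is used. [cite: Zywina2025, Thm 1.2] -/
theorem exists_rank_two_door_at_two :
    ∃ W : WeierstrassCurve ℚ, W.IsElliptic ∧ W.mordellWeilRank = 2 ∧ W.shaCorank 2 = 0 :=
  ⟨zywinaCurve 659 12, isElliptic_zywinaCurve zywinaAdmissible_659_12,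
    door_two_zywinaCurve zywinaAdmissible_659_12⟩

/-- The same witness on a GLOBAL MINIMAL MODEL with the torsion read off (`E(ℚ) ≅ ℤ/2 × ℤ²`, Zywina Thm. 1.2
verbatim, tree `mordellWeilRank_eq_two_and_torsionOrder_eq_two`, `isGloballyMinimal_zywinaCurve`): the form in
which KatoTransfer's items (stated on global minimal models) consume the door. [cite: Zywina2025, Thm 1.2, Lemma 3.4] -/
theorem exists_minimal_rank_two_door_at_two :
    ∃ W : WeierstrassCurve ℚ, W.IsElliptic ∧ W.IsGloballyMinimal ∧ W.mordellWeilRank = 2 ∧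
      W.torsionOrder = 2 ∧ W.shaCorank 2 = 0 :=
  ⟨zywinaCurve 659 12, isElliptic_zywinaCurve zywinaAdmissible_659_12,
    isGloballyMinimal_zywinaCurve zywinaAdmissible_659_12,
    mordellWeilRank_zywinaCurve zywinaAdmissible_659_12, torsionOrder_zywinaCurve zywinaAdmissible_659_12,
    shaCorank_two_zywinaCurve zywinaAdmissible_659_12⟩

/-! ## §2 T's first open instances, explicit -/

/-- **T predicts `t_q(E_{m,n}) = 0` at every prime.** Granting `FiniteShaComponentTransfer`, the certified door
datum `t_2(E_{m,n}) = 0` transfers: `corank_{ℤ_q} Ш(E_{m,n}/ℚ)[q^∞] = 0` for every prime `q`. At rank 2 no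
theorem in print decides any of these instances. CONDITIONAL on `hT` (the crux itself).
[cite: Zywina2025, §1 (remark after Thm 1.2)] -/
theorem shaCorank_zywinaCurve_eq_zero_of_transfer (hT : FiniteShaComponentTransfer)
    (h : ZywinaAdmissible m n) (q : ℕ) [Fact q.Prime] : (zywinaCurve m n).shaCorank q = 0 := by
  haveI := isElliptic_zywinaCurve h
  exact hT (zywinaCurve m n) 2 q (shaCorank_two_zywinaCurve h)

/-- Granting T, `Ш(E_{m,n}/ℚ)[q^∞]` is FINITE at every prime `q` (`t_q = 0 ↔` finite, tree theorem
`finite_primaryComponent_sha_iff_shaCorank_eq_zero`). CONDITIONAL on `hT`. [cite: Greenberg1999LNM, §1 pp. 54–57] -/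
theorem finite_sha_primary_zywinaCurve_of_transfer (hT : FiniteShaComponentTransfer)
    (h : ZywinaAdmissible m n) (q : ℕ) [Fact q.Prime] :
    Finite ↥(AddCommGroup.primaryComponent (zywinaCurve m n).sha q) := by
  haveI := isElliptic_zywinaCurve h
  exact (finite_primaryComponent_sha_iff_shaCorank_eq_zero (zywinaCurve m n) q).2
    (shaCorank_zywinaCurve_eq_zero_of_transfer hT h q)

/-! ## §3 Selmer coordinates: what an instrument must certify (unconditional) -/

/-- **`corank_{ℤ_q} Sel_{q^∞}(E_{m,n}/ℚ) = 2 + t_q(E_{m,n})`** at every prime `q`: Greenberg's identity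
`corank Sel_{q^∞} = rank + corank Ш[q^∞]` (tree theorem `selmerCorank_eq_mordellWeilRank_add_holds`) with
`rank = 2` (Zywina). Unconditional. [cite: Greenberg1999LNM, §1 pp. 54–57] [cite: Zywina2025, Thm 1.2] -/
theorem selmerCorank_zywinaCurve_eq (h : ZywinaAdmissible m n) (q : ℕ) [Fact q.Prime] :
    (zywinaCurve m n).selmerCorank q = 2 + (zywinaCurve m n).shaCorank q := by
  haveI := isElliptic_zywinaCurve h
  rw [(zywinaCurve m n).selmerCorank_eq_mordellWeilRank_add_holds q, mordellWeilRank_zywinaCurve h]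

/-- `2 ≤ corank_{ℤ_q} Sel_{q^∞}(E_{m,n}/ℚ)` at every prime (Kummer: the two independent points).
Unconditional. [cite: Greenberg1999LNM, §1 pp. 54–57] -/
theorem two_le_selmerCorank_zywinaCurve (h : ZywinaAdmissible m n) (q : ℕ) [Fact q.Prime] :
    2 ≤ (zywinaCurve m n).selmerCorank q := by
  rw [selmerCorank_zywinaCurve_eq h q]
  exact Nat.le_add_right 2 _

/-- **What must be certified at `q`.** `t_q(E_{m,n}) = 0 ⟺ corank_{ℤ_q} Sel_{q^∞}(E_{m,n}/ℚ) ≤ 2`: an upper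
bound `2` on the `q^∞`-Selmer corank is necessary and sufficient for T's instance `(E_{m,n}, 2, q)` (e.g. a
`λ`-door `μ_q = 0 ∧ λ_q = 2` through Kato's divisibility would supply it). Unconditional.
[cite: Greenberg1999LNM, §1 pp. 54–57] -/
theorem shaCorank_zywinaCurve_eq_zero_iff (h : ZywinaAdmissible m n) (q : ℕ) [Fact q.Prime] :
    (zywinaCurve m n).shaCorank q = 0 ↔ (zywinaCurve m n).selmerCorank q ≤ 2 := by
  rw [selmerCorank_zywinaCurve_eq h q]
  omega

/-- Granting T, **`corank_{ℤ_q} Sel_{q^∞}(E_{m,n}/ℚ) = 2` at every prime `q`** — the `p`-independence of the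
Selmer corank on an explicit rank-2 family, which is what T asserts there. CONDITIONAL on `hT`.
[cite: Greenberg1999LNM, §1 pp. 54–57] -/
theorem selmerCorank_zywinaCurve_of_transfer (hT : FiniteShaComponentTransfer)
    (h : ZywinaAdmissible m n) (q : ℕ) [Fact q.Prime] : (zywinaCurve m n).selmerCorank q = 2 := by
  rw [selmerCorank_zywinaCurve_eq h q, shaCorank_zywinaCurve_eq_zero_of_transfer hT h q]

/-- Unconditionally at `q = 2`: `corank_{ℤ₂} Sel_{2^∞}(E_{m,n}/ℚ) = 2` (tree `selmerCorank_two_zywinaCurve`) —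
the one instance of the previous statement that IS a theorem. [cite: Zywina2025, Lemma 3.5] -/
theorem selmerCorank_two_zywinaCurve' (h : ZywinaAdmissible m n) : (zywinaCurve m n).selmerCorank 2 = 2 :=
  selmerCorank_two_zywinaCurve h

/-! ## §4 Parity: consistent and idle -/

/-- Granting the `2`-parity theorem for `E_{m,n}` (Dokchitser–Dokchitser 2010 Thm. 1.4 / Monsky, named fact
`p_parity · 2`: `(-1)^{corank Sel_{2^∞}} = w`), the global root number of `E_{m,n}` is `+1`, because
`corank_{ℤ₂} Sel_{2^∞}(E_{m,n}/ℚ) = 2` is a theorem (cf. tree `rootNumber_zywinaCurve`, same content for the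
class-wide form of the fact). CONDITIONAL on `h2`. [cite: DokchitserDokchitserAnnals2010, Thm. 1.4] [cite: Zywina2025, §1.1] -/
theorem rootNumber_zywinaCurve_of_two_parity (h : ZywinaAdmissible m n) (h2 : p_parity (zywinaCurve m n) 2) :
    (zywinaCurve m n).rootNumber = 1 := by
  have h1 : (-1 : ℤ) ^ (zywinaCurve m n).selmerCorank 2 = (zywinaCurve m n).rootNumber := h2
  rw [selmerCorank_two_zywinaCurve h] at h1
  rw [← h1]
  norm_num

/-- Granting the `p`-parity theorem at `2` and at `q` (Dokchitser–Dokchitser 2010 Thm. 1.4, named facts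
`p_parity · 2`, `p_parity · q`), **`t_q(E_{m,n})` is even** — so `corank Sel_{q^∞}(E_{m,n}) ∈ {2, 4, 6, …}`;
T asks for `2`. CONDITIONAL on `h2`, `hq`. [cite: DokchitserDokchitserAnnals2010, Thm. 1.4] -/
theorem even_shaCorank_zywinaCurve_of_p_parity (h : ZywinaAdmissible m n) (q : ℕ) [Fact q.Prime]
    (h2 : p_parity (zywinaCurve m n) 2) (hq : p_parity (zywinaCurve m n) q) :
    Even ((zywinaCurve m n).shaCorank q) := by
  have hw := rootNumber_zywinaCurve_of_two_parity h h2
  have hq' : (-1 : ℤ) ^ (zywinaCurve m n).selmerCorank q = (zywinaCurve m n).rootNumber := hq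
  rw [hw, selmerCorank_zywinaCurve_eq h q, pow_add] at hq'
  norm_num at hq'
  exact (neg_one_pow_eq_one_iff_even (by norm_num)).1 hq'

/-- Granting `p`-parity at `2` and `q`: `corank_{ℤ_q} Sel_{q^∞}(E_{m,n}/ℚ)` is even (and `≥ 2`).
CONDITIONAL on `h2`, `hq`. [cite: DokchitserDokchitserAnnals2010, Thm. 1.4] -/
theorem even_selmerCorank_zywinaCurve_of_p_parity (h : ZywinaAdmissible m n) (q : ℕ) [Fact q.Prime]
    (h2 : p_parity (zywinaCurve m n) 2) (hq : p_parity (zywinaCurve m n) q) :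
    Even ((zywinaCurve m n).selmerCorank q) := by
  rw [selmerCorank_zywinaCurve_eq h q]
  exact (even_two).add (even_shaCorank_zywinaCurve_of_p_parity h q h2 hq)

/-! ## §5 Rank-BSD for the family from the route's cruxes -/

/-- **Lower bound from Gross–Zagier–Kolyvagin**: `2 ≤ ord_{s=1} L(E_{m,n}, s)`. If the analytic rank were
`≤ 1`, GZK (named fact `rank_eq_analyticRank_of_analyticRank_le_one`) would force `rank E_{m,n}(ℚ) ≤ 1`,
against Zywina's `rank = 2`. CONDITIONAL on `hGZK`. [cite: Kolyvagin1990, Thm. A] [cite: Zywina2025, Thm 1.2] -/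
theorem two_le_analyticRank_zywinaCurve_of_GZK (hGZK : rank_eq_analyticRank_of_analyticRank_le_one)
    (h : ZywinaAdmissible m n) : 2 ≤ (zywinaCurve m n).analyticRank := by
  haveI := isElliptic_zywinaCurve h
  by_contra hlt
  have hr := (hGZK (zywinaCurve m n) (by omega)).1
  have h2 := mordellWeilRank_zywinaCurve h
  omega

/-- `E_{m,n}` (on its global minimal model, instances `isElliptic_zywinaCurve`, `isGloballyMinimal_zywinaCurve`)
has a good ordinary prime `q ≥ 5` — every elliptic curve over `ℚ` has infinitely many (tree theorem
`infinite_goodOrdinaryPrimes_holds`, Serre 1981 §8 / Deuring). Unconditional. [cite: Serre1981, §8 Cor. 2] -/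
theorem exists_goodOrdinary_zywinaCurve (m n : ℕ) [(zywinaCurve m n).IsElliptic]
    [(zywinaCurve m n).IsGloballyMinimal] :
    ∃ (q : ℕ) (_ : Fact q.Prime), 5 ≤ q ∧ (zywinaCurve m n).HasGoodReductionAtPrime q ∧
      ¬ (q : ℤ) ∣ (zywinaCurve m n).frobeniusTrace q :=
  exists_good_ordinary_prime_of_infinite infinite_goodOrdinaryPrimes_holds (zywinaCurve m n)

/-- **Upper bound from T ∧ X2**: `ord_{s=1} L(E_{m,n}, s) ≤ 2`. At a good ordinary prime `q ≥ 5` of the global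
minimal model `E_{m,n}` (exists, unconditionally), X2 = `AnalyticRankLeSelmerCorank` gives
`ord ≤ corank Sel_{q^∞} = 2 + t_q`, and T (from the certified `t_2 = 0`) gives `t_q = 0`.
CONDITIONAL on `hT`, `hX2` (the route's cruxes). [cite: Greenberg1999LNM, §1 pp. 54–57] -/
theorem analyticRank_zywinaCurve_le_two_of_transfer_X2 (hT : FiniteShaComponentTransfer)
    (hX2 : AnalyticRankLeSelmerCorank) (h : ZywinaAdmissible m n) : (zywinaCurve m n).analyticRank ≤ 2 := by
  haveI := isElliptic_zywinaCurve h
  haveI := isGloballyMinimal_zywinaCurve h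
  obtain ⟨q, hq, h5, hgood, hord⟩ := exists_goodOrdinary_zywinaCurve m n
  have hle := hX2 (zywinaCurve m n) q h5 hgood hord
  rw [selmerCorank_zywinaCurve_of_transfer hT h q] at hle
  exact hle

/-- **Upper bound from KatoTransfer's X1 ∧ X2 instead**: if `t_q(E_{m,n}) = 0` at SOME good ordinary `q ≥ 5`
(X1 = `ShaCorankZeroAtOnePrime`, stmt-18411) then X2 there gives `ord_{s=1} L(E_{m,n}, s) ≤ 2` — the door at 2
is not needed on this path, the transfer not needed on the other. CONDITIONAL on `hX1`, `hX2`.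
[cite: Greenberg1999LNM, §1 pp. 54–57] -/
theorem analyticRank_zywinaCurve_le_two_of_X1_X2 (hX1 : ShaCorankZeroAtOnePrime)
    (hX2 : AnalyticRankLeSelmerCorank) (h : ZywinaAdmissible m n) : (zywinaCurve m n).analyticRank ≤ 2 := by
  haveI := isElliptic_zywinaCurve h
  haveI := isGloballyMinimal_zywinaCurve h
  obtain ⟨q, hq, h5, hgood, hord, h0⟩ := hX1 (zywinaCurve m n)
  have hle := hX2 (zywinaCurve m n) q h5 hgood hord
  rw [selmerCorank_zywinaCurve_eq h q, h0] at hle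
  exact hle

/-- **Rank-BSD for Zywina's family from the route's cruxes.** Granting T (`FiniteShaComponentTransfer`), X2
(`AnalyticRankLeSelmerCorank`) and Gross–Zagier–Kolyvagin: `ord_{s=1} L(E_{m,n}, s) = 2 = rank E_{m,n}(ℚ)` for
every admissible `(m, n)`. The door (O) is NOT assumed — it is the theorem `t_2(E_{m,n}) = 0`.
CONDITIONAL on `hT`, `hX2`, `hGZK`; BSD is not proved by this. [cite: Zywina2025, Thm 1.2]
[cite: Kolyvagin1990, Thm. A] -/
theorem analyticRank_zywinaCurve_eq_two_of_transfer (hT : FiniteShaComponentTransfer)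
    (hX2 : AnalyticRankLeSelmerCorank) (hGZK : rank_eq_analyticRank_of_analyticRank_le_one)
    (h : ZywinaAdmissible m n) :
    (zywinaCurve m n).analyticRank = 2 ∧ (zywinaCurve m n).analyticRank = (zywinaCurve m n).mordellWeilRank := by
  have hle := analyticRank_zywinaCurve_le_two_of_transfer_X2 hT hX2 h
  have hge := two_le_analyticRank_zywinaCurve_of_GZK hGZK h
  have hr := mordellWeilRank_zywinaCurve h
  omega

/-- The analytic form of parity (named fact `selmerCorank_mod_two_eq · 2`: `corank Sel_{2^∞} ≡ ord_{s=1} L (mod 2)`)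
makes `ord_{s=1} L(E_{m,n}, s)` EVEN (`corank Sel_{2^∞}(E_{m,n}) = 2` is a theorem); with GZK it is an even
number `≥ 2` — T ∧ X2 pick `2`. CONDITIONAL on `hpar`. [cite: DokchitserDokchitserAnnals2010, Thm. 1.4] -/
theorem even_analyticRank_zywinaCurve_of_parity (h : ZywinaAdmissible m n)
    (hpar : selmerCorank_mod_two_eq (zywinaCurve m n) 2) : Even ((zywinaCurve m n).analyticRank) := by
  have h2 : (zywinaCurve m n).selmerCorank 2 % 2 = (zywinaCurve m n).analyticRank % 2 := hpar
  rw [selmerCorank_two_zywinaCurve h] at h2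
  exact Nat.even_iff.2 (by omega)

/-! ## §6 T on the family, hypothesis discharged -/

/-- **T restricted to the door data `(E_{m,n}, 2)` is EXACTLY «`Ш(E_{m,n}/ℚ)[q^∞]` is finite for every admissible
`(m, n)` and every prime `q`»** — the hypothesis of T being discharged by the kernel. So one admissible pair and
one prime `q` with `Ш(E_{m,n})[q^∞]` infinite would refute T (no instrument certifies `t_q > 0`; recorded as the
exact shape of a counterexample on kernel-certified door data). [folklore] -/
theorem transfer_on_zywinaFamily_iff :
    (∀ (m n : ℕ), ZywinaAdmissible m n → ∀ (q : ℕ) [Fact q.Prime],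
        (zywinaCurve m n).shaCorank 2 = 0 → (zywinaCurve m n).shaCorank q = 0) ↔
      ∀ (m n : ℕ), ZywinaAdmissible m n → ∀ (q : ℕ) [Fact q.Prime],
        Finite ↥(AddCommGroup.primaryComponent (zywinaCurve m n).sha q) := by
  constructor
  · intro H m n h q _
    haveI := isElliptic_zywinaCurve h
    exact (finite_primaryComponent_sha_iff_shaCorank_eq_zero (zywinaCurve m n) q).2
      (H m n h q (shaCorank_two_zywinaCurve h))
  · intro H m n h q _ _
    haveI := isElliptic_zywinaCurve h
    exact (finite_primaryComponent_sha_iff_shaCorank_eq_zero (zywinaCurve m n) q).1 (H m n h q)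

/-! ## §7 Infinitely many `j`-invariants in O's open sector (appended; modulo Tao–Ziegler) -/

/-- **Infinitely many `j`-invariants of rank-2 curves with the door at 2 open**, modulo the named fact
`zywinaSet_infinite` (infinitely many admissible pairs; Zywina §4, derived in the tree from Tao–Ziegler as
`zywinaSet_infinite_of_taoZiegler`): the set of `j ∈ ℚ` carried by an elliptic `W/ℚ` with `rank W(ℚ) = 2` and
`corank_{ℤ₂} Ш(W)[2^∞] = 0` is infinite — distinct admissible pairs have distinct `j` (tree `eq_of_j_eq`,
Zywina Lemma 4.1). Unconditionally the set is non-empty (`exists_rank_two_door_at_two`). So O's open sector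
«rank ≥ 2» contains infinitely many isomorphism classes over `ℚ̄` on which O HOLDS. CONDITIONAL on `hZ`.
[cite: Zywina2025, Thm 1.1, Lemma 4.1] -/
theorem infinite_setOf_j_rank_two_door_at_two (hZ : zywinaSet_infinite) :
    {j : ℚ | ∃ (W : WeierstrassCurve ℚ) (hW : W.IsElliptic),
      @WeierstrassCurve.j _ _ W hW = j ∧ W.mordellWeilRank = 2 ∧ W.shaCorank 2 = 0}.Infinite := by
  classical
  let f : ℕ × ℕ → ℚ := fun p =>
    if hp : ZywinaAdmissible p.1 p.2 then
      @WeierstrassCurve.j _ _ (zywinaCurve p.1 p.2) (isElliptic_zywinaCurve hp) else 0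
  have hinj : Set.InjOn f zywinaSet := by
    rintro ⟨m₁, n₁⟩ h₁ ⟨m₂, n₂⟩ h₂ he
    have h₁' : ZywinaAdmissible m₁ n₁ := h₁
    have h₂' : ZywinaAdmissible m₂ n₂ := h₂
    simp only [f, dif_pos h₁', dif_pos h₂'] at he
    obtain ⟨rfl, rfl⟩ := eq_of_j_eq h₁' h₂' he
    rfl
  refine Set.infinite_of_injOn_mapsTo hinj ?_ hZ
  rintro ⟨m, n⟩ hp
  have hp' : ZywinaAdmissible m n := hp
  exact ⟨zywinaCurve m n, isElliptic_zywinaCurve hp', by simp only [f, dif_pos hp'],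
    mordellWeilRank_zywinaCurve hp', shaCorank_two_zywinaCurve hp'⟩

end Summit.BirchSwinnertonDyer.BirchSwinnertonDyer.Theorems.ShaPrimaryTransferRankTwoDoor
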